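import Summits.Langlands.Langlands.Theses.ParityBlindBianchi
import Summits.Langlands.Langlands.Theorems.ParityBlindBianchiResidualBianchiDoorLevelR
import Summits.Langlands.Langlands.Theorems.ResidualBianchiDoorLevel.Negative.FalseWithoutIcosahedral
import Summits.Langlands.Langlands.Theorems.ResidualBianchiDoorLevel.Negative.LoopholeRegAlgCuspidal
import Summits.Langlands.Langlands.Theorems.ResidualBianchiDoorLevel.Negative.PredictedPolyFalseWithoutOdd
import Summits.Langlands.Langlands.Theorems.IcosahedralDescentLevel.Negative.AllParityOfDoorOfDescent
import HarnessLib

/-!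
# Disproof of `ResidualBianchiDoorLevelBC` (E1″, item stmt-Langlands-16853) — findings

Disprover's work file (cdisprove, cycle 1, refuter-cdisprove-stmt-Langlands-16853-0, 2026-08-17).
Verdict: **NO KILL — and no kill is possible short of refuting Serre's conjecture mod 2 as typed in
the tree.**  Everything below is kernel-checked (`lean check` rc 0, 0 sorry); prose lives in docstrings.

The crux is `QuadraticBaseChangeGL2 → ResidualBianchiDoorLevelR` (`crux_iff`, `Iff.rfl`): the
BC-conditional residual door E1″ = (cuspidal quadratic base change for GL₂, A–C III.4.2(a)/5.1, as an
antecedent BY NAME) → (E1′R: Khare–Wintenberger mod 2 + BC_K of the KW newform, congruent to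
`ι⁻¹ρ|_K` at EVERY place of `K` over no element of a UNIFORM finite `S₀ ∋ 2`, `0 ∉ S₀`).

* §0 `crux_iff`, `PerField`, `crux_iff_perField` — shape; the per-field conclusion isolated as a
  predicate (definitionally), antitone in `S₀` (`PerField.mono`).
* §1 STRUCTURE OF ANY KILL: `quadraticBaseChangeGL2_of_not_crux`, `not_levelR_of_not_crux`,
  `not_crux_iff` — `¬E1″ ↔ QBC ∧ ¬E1′R`: an unconditional refutation must PROVE quadratic base change
  for GL₂ in the tree (XL apex, promoted crux stmt-16812) AND refute E1′R;
  `facts_inconsistent_of_not_crux` — by the landed p125055 (`ResidualBianchiDoorLevelR_of_facts`) a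
  kill makes the four cited facts {`khare_wintenberger` (all `p`), `baseChange_cyclic_cuspidal`,
  `ArthurClozel1989_strongLifting_archimedean`, `…_allFinite`} jointly inconsistent;
  `not_serreModTwo_of_not_crux_of_line` — modulo the picked line's closing theorem
  (`Cruxes/ResidualBianchiDoorLevelBC/SketchIdeator2.lean ::
  FibreSubstitution.ResidualBianchiDoorLevelBC_of_serreModTwo`, re-checked by THIS seat: lean check
  rc 0, 0 sorry, axioms {propext, Classical.choice, Quot.sound}) a kill is EXACTLY a refutation of
  `∀ k, khare_wintenberger 2 k` (Serre's conjecture mod 2, KW 2009 Thm 1.2/9.1 + Kisin 2009) as typed.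
* §2 THE `0 ∉ S₀` REPAIR BITES (vs. the vacuous sibling E1′, stmt-15112, whose typed content was
  "regular algebraic cuspidal reps exist", `ResidualBianchiDoorLevel.Negative.*`):
  `finite_bad_places`, `infinite_good_places`, `exists_good_place_iff` — a witness `S₀` of E1″ leaves
  all but finitely many places of `K` good (infinitely many), and `(∃ good place) ↔ 0 ∉ S₀`; so the
  congruence clause of E1″ has content at infinitely many places of every admissible `K`.
* §3 LOAD-BEARING / DECORATION analysis of every hypothesis and conjunct:
  - `withoutIcosahedral_iff_not_QBC` — dropping the two hypotheses on `ρ` (`hirr`, `hA5`) turns E1″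
    into the NEGATION of its own antecedent (witness inherited from the landed sibling lemma: trivial
    `ρ`, `K = ℚ(√-15)`); `hA5` is load-bearing.
  - `crux_iff_withoutHirr` — `hirr` is decoration (`hA5 ⇒ hirr`, landed `isIrreducible_of_icosahedral`).
  - `crux_iff_withoutTwoMem` — NEW: the conclusion conjunct `2 ∈ S₀` is decoration AS A STATEMENT
    (witnesses may always be enlarged by `2`, `PerField.mono`); it is load-bearing only inside the
    PROOF (the congruence normalisation fails at residue characteristic 2:
    landed `ResidualBianchiDoorLevel.Negative.stub_predictedPolyCongr_false_without_odd`).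
  - `crux_of_forAllQuadratic` — the field hypotheses `IsTotallyComplex K` and "2 splits in K" only
    WEAKEN the crux; the picked line's proof never uses them (`_htc`, `_hsplit` unused binders), i.e.
    it proves the door for EVERY quadratic `K`, real or imaginary, 2 split or not.
  - `crux_of_levelR`, `levelR_of_crux` — E1″ is E1′R weakened by the antecedent; given QBC they agree.
  - antecedent clause (b) of `QuadraticBaseChangeGL2` (unramified strong lifting + descent of
    unramifiedness) is NOT used by the line (only `hQ.1`, `hQ.2.2.1`, `hQ.2.2.2`): possibly unnecessary.
* §4 NATURAL STRENGTHENINGS THAT ARE FALSE (inherited, landed for the sibling E1′ and valid verbatim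
  here since the congruence clause is identical): congruence `‖·‖ < 1` ↦ equality of polynomials
  (`not_predictedPoly_eq_exact`, sibling Disproof §6: `q = 3, k = 2, H = (X-1)²` gives `1` vs `1/9`);
  normalisation at `q = 2` (`stub_predictedPolyCongr_false_without_odd`: coefficients differ by `3/4`,
  2-adic norm `4`) — re-exported below as `strengthening_*` one-liners.
* §5 `line_Sketch_verdicts` (docstring) — the picked line `Sketch` (idea fibre-substitution) is
  COMPLETE: both stubs (`stub_qLevel_two`, `stub_bcTransfer_fibre`) are sorry-free, joint sufficiency
  `ResidualBianchiDoorLevelBC_of_serreModTwo` concludes the crux BY NAME from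
  `∀ k, khare_wintenberger 2 k` alone; nothing to break; hypothesis-minimality notes per stub.
* §6 `trust_base_reading` (docstring) — re-read of `SerreModularityConjecture 2 k` and its recipe
  defs (`serreLevel`, `serreWeightLocal`, `IsOdd`, premises `[CharP k 2] [IsAlgClosed k]` INSIDE the
  Prop): faithful to Serre (3.2.4) with the character left free and the `p = 2` weight conventions
  (`k ∈ {2,4}`, landed `isSerreWeight_two_cases`); no junk instance of `k` bites (non-char-2 or
  non-algebraically-closed `k` make the premise vacuous).  Not refutable in Lean (no explicit
  irreducible `ρ̄`, no dimension formula for `S_k(Γ₁(N))`), and true in print.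

Nothing here is a refutation of the crux.  §3 (`withoutIcosahedral_iff_not_QBC`,
`crux_iff_withoutTwoMem`) and §2 are proposed under `Theorems/ResidualBianchiDoorLevelBC/Negative/`.
-/

noncomputable section

namespace Summit.Langlands.Langlands.Cruxes.ResidualBianchiDoorLevelBC.Disproof

set_option linter.dupNamespace false

open scoped MatrixGroups Polynomial NumberField
open Polynomial NumberField IsDedekindDomain Field
open Literature.NumberTheory.Automorphic Literature.NumberTheory.GaloisRepresentations
  Summit.Langlands.Langlands.Theses.ParityBlindBianchi
  Summit.Langlands.Langlands.Theorems

/-! ## §0 Shape of the crux -/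

/-- **E1″ is `QuadraticBaseChangeGL2 → ResidualBianchiDoorLevelR` on the nose** (the route docstring's
`rfl` claim, re-certified at route rev 18). [folklore] -/
theorem crux_iff :
    ResidualBianchiDoorLevelBC ↔ (QuadraticBaseChangeGL2 → ResidualBianchiDoorLevelR) :=
  Iff.rfl

/-- **The per-field conclusion of E1″** for `(ι, ρ, S₀, K)`: the entrywise `ι`-model `σ` of `ρ|_K`
with its four Galois-side conjuncts and a regular algebraic cuspidal `π₀` on `GL₂(𝔸_K)` congruent to
`σ` at every place of `K` over no element of `S₀` (verbatim the body of the crux after the field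
hypotheses). -/
def PerField (ι : PadicAlgCl 2 ≃+* ℂ) (ρ : FramedGaloisRep ℚ ℂ 2) (S₀ : Finset ℕ)
    (K : Type) [Field K] [NumberField K] : Prop :=
  ∃ σ : FramedGaloisRep K (PadicAlgCl 2) 2,
    (∀ (g : absoluteGaloisGroup K) (i j : Fin 2),
      ι ((σ g).val i j) = ((FramedGaloisRep.restrictField K ρ) g).val i j) ∧
    Finite σ.toMonoidHom.range ∧ σ.toGaloisRep.IsIrreducible ∧
    Nonempty ((Matrix.ProjGenLinGroup.mk.comp σ.toMonoidHom).range ≃* alternatingGroup (Fin 5)) ∧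
    ∃ (hcpt : isCompact_glFiniteIntegralLevel 2 K) (π₀ : CuspidalAutomorphicRepData 2 K hcpt),
      π₀.1.IsRegularAlgebraic ∧
      ∀ v : HeightOneSpectrum (𝓞 K), (∀ ℓ ∈ S₀, ((ℓ : ℕ) : 𝓞 K) ∉ v.asIdeal) →
        ∃ (α : Multiset ℂ) (P : Polynomial (PadicAlgCl 2)), π₀.1.HasSatakeParamAt v α ∧
          σ.IsUnramifiedAt v ∧ σ.HasFrobCharpolyAt v P ∧
          ∀ i : ℕ, ‖P.coeff i - (arithFrobPolyOfSatake ι v.residueCard 2 α).coeff i‖ < 1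

/-- The field hypotheses of the crux on `K`: totally complex, quadratic, `2` split. -/
def AdmissibleField (K : Type) [Field K] [NumberField K] : Prop :=
  IsTotallyComplex K ∧ Module.finrank ℚ K = 2 ∧
    ∃ v w : HeightOneSpectrum (𝓞 K), v ≠ w ∧ ((2 : ℕ) : 𝓞 K) ∈ v.asIdeal ∧
      ((2 : ℕ) : 𝓞 K) ∈ w.asIdeal

/-- **E1″ through `PerField`** (definitional unfolding, `Iff.rfl` up to currying the three field
hypotheses). [folklore] -/
theorem crux_iff_perField :
    ResidualBianchiDoorLevelBC ↔
      (QuadraticBaseChangeGL2 → ∀ (ι : PadicAlgCl 2 ≃+* ℂ) (ρ : FramedGaloisRep ℚ ℂ 2),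
        ρ.toGaloisRep.IsIrreducible →
        Nonempty ((Matrix.ProjGenLinGroup.mk.comp ρ.toMonoidHom).range ≃* alternatingGroup (Fin 5)) →
        ∃ S₀ : Finset ℕ, 2 ∈ S₀ ∧ (0 : ℕ) ∉ S₀ ∧
          ∀ (K : Type) [Field K] [NumberField K], IsTotallyComplex K → Module.finrank ℚ K = 2 →
            (∃ v w : HeightOneSpectrum (𝓞 K), v ≠ w ∧ ((2 : ℕ) : 𝓞 K) ∈ v.asIdeal ∧
              ((2 : ℕ) : 𝓞 K) ∈ w.asIdeal) → PerField ι ρ S₀ K) :=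
  Iff.rfl

/-- **`PerField` is monotone in `S₀`** (more bad primes = fewer good places = weaker demand): the
elementary reason why the conjunct `2 ∈ S₀` costs nothing (§3) and why "larger `S₀` is weaker".
[folklore] -/
theorem PerField.mono {ι : PadicAlgCl 2 ≃+* ℂ} {ρ : FramedGaloisRep ℚ ℂ 2} {S₀ S₁ : Finset ℕ}
    (hS : S₀ ⊆ S₁) {K : Type} [Field K] [NumberField K] (h : PerField ι ρ S₀ K) :
    PerField ι ρ S₁ K := by
  obtain ⟨σ, hmodel, hfin, hirr, hA5, hcpt, π₀, hRA, hgood⟩ := h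
  exact ⟨σ, hmodel, hfin, hirr, hA5, hcpt, π₀, hRA,
    fun v hv => hgood v fun ℓ hℓ => hv ℓ (hS hℓ)⟩

/-! ## §1 The structure of any kill -/

/-- **A kill must PROVE quadratic base change for GL₂ in the tree.**  `¬(A → B) ⊢ A`: any
unconditional refutation of E1″ contains a proof of `QuadraticBaseChangeGL2` (Langlands 1980 /
Arthur–Clozel III.4.2(a), 5.1 — the promoted XL-apex crux stmt-Langlands-16812, not provable in the
tree today).  This alone rules out an unconditional `¬E1″` this cycle. [folklore] -/
theorem quadraticBaseChangeGL2_of_not_crux (h : ¬ ResidualBianchiDoorLevelBC) :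
    QuadraticBaseChangeGL2 := by
  by_contra hq
  exact h fun q => absurd q hq

/-- **A kill must refute E1′R** (the support item stmt-Langlands-16621, proved modulo cited facts by
p125055). [folklore] -/
theorem not_levelR_of_not_crux (h : ¬ ResidualBianchiDoorLevelBC) : ¬ ResidualBianchiDoorLevelR :=
  fun hR => h fun _ => hR

/-- **`¬E1″ ↔ QBC ∧ ¬E1′R`.** [folklore] -/
theorem not_crux_iff :
    ¬ ResidualBianchiDoorLevelBC ↔ QuadraticBaseChangeGL2 ∧ ¬ ResidualBianchiDoorLevelR :=
  ⟨fun h => ⟨quadraticBaseChangeGL2_of_not_crux h, not_levelR_of_not_crux h⟩,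
    fun ⟨hq, hR⟩ h => hR (h hq)⟩

/-- **E1′R ⇒ E1″** (weakening by the antecedent). [folklore] -/
theorem crux_of_levelR (h : ResidualBianchiDoorLevelR) : ResidualBianchiDoorLevelBC := fun _ => h

/-- **E1″ + QBC ⇒ E1′R** (modus ponens; how `closes` consumes the item). [folklore] -/
theorem levelR_of_crux (h : ResidualBianchiDoorLevelBC) (hQ : QuadraticBaseChangeGL2) :
    ResidualBianchiDoorLevelR :=
  h hQ

/-- **A kill makes the four cited facts of p125055 jointly inconsistent.**  The landed
`ParityBlindBianchi.ResidualBianchiDoorLevelR_of_facts` (Theorems/ParityBlindBianchiResidualBianchiDoorLevelR)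
derives E1′R from Khare–Wintenberger (all `p`; used at `p = 2` only), cuspidal cyclic base change,
and Arthur–Clozel strong lifting (archimedean, all finite places); so `¬E1″ ⊢ ¬(their conjunction)`.
Each is a faithful weakening of a theorem in print. [folklore] -/
theorem facts_inconsistent_of_not_crux (h : ¬ ResidualBianchiDoorLevelBC) :
    ¬ ((∀ (p : ℕ) [Fact p.Prime] (k : Type) [Field k] [TopologicalSpace k] [DiscreteTopology k],
          khare_wintenberger p k) ∧
        baseChange_cyclic_cuspidal ∧ ArthurClozel1989_strongLifting_archimedean ∧
        ArthurClozel1989_strongLifting_allFinite) :=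
  fun ⟨hKW, hBC, hArch, hR1⟩ =>
    not_levelR_of_not_crux h (ParityBlindBianchi.ResidualBianchiDoorLevelR_of_facts hKW hBC hArch hR1)

/-- **Modulo the picked line, a kill is EXACTLY a refutation of Serre's conjecture mod 2 as typed.**
The line `Sketch` (Cruxes/ResidualBianchiDoorLevelBC/SketchIdeator2.lean, lead
prover-line-stmt-Langlands-16853-0) proves
`FibreSubstitution.ResidualBianchiDoorLevelBC_of_serreModTwo :
(∀ k [Field k] [TopologicalSpace k] [DiscreteTopology k], khare_wintenberger 2 k) → ResidualBianchiDoorLevelBC`;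
this seat re-ran it (copy `LineSketch.lean`: lean check rc 0, 0 sorry, 0 warnings,
`#print axioms` = {propext, Classical.choice, Quot.sound}).  A Cruxes module cannot be imported here,
so the implication is taken as the hypothesis `hline`; once the lead lands it under Theorems/ the
hypothesis is discharged by name. [folklore] -/
theorem not_serreModTwo_of_not_crux_of_line
    (hline : (∀ (k : Type) [Field k] [TopologicalSpace k] [DiscreteTopology k],
      khare_wintenberger 2 k) → ResidualBianchiDoorLevelBC)
    (h : ¬ ResidualBianchiDoorLevelBC) :
    ¬ ∀ (k : Type) [Field k] [TopologicalSpace k] [DiscreteTopology k], khare_wintenberger 2 k :=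
  fun hKW2 => h (hline hKW2)

/-! ## §2 The `0 ∉ S₀` repair bites: a witness leaves infinitely many good places -/

/-- **Bad places are finite when `0 ∉ S₀`.**  Each `ℓ ∈ S₀` is then a non-zero natural, so
`(ℓ) ⊆ 𝓞 K` is a non-zero ideal with finitely many prime factors (`Ideal.finite_factors`); a place is
bad iff it divides one of them. [folklore] -/
theorem finite_bad_places {K : Type} [Field K] [NumberField K] {S₀ : Finset ℕ} (h0 : (0 : ℕ) ∉ S₀) :
    {v : HeightOneSpectrum (𝓞 K) | ¬ ∀ ℓ ∈ S₀, ((ℓ : ℕ) : 𝓞 K) ∉ v.asIdeal}.Finite := by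
  have hsub : {v : HeightOneSpectrum (𝓞 K) | ¬ ∀ ℓ ∈ S₀, ((ℓ : ℕ) : 𝓞 K) ∉ v.asIdeal} ⊆
      ⋃ ℓ ∈ S₀, {v : HeightOneSpectrum (𝓞 K) | v.asIdeal ∣ Ideal.span {((ℓ : ℕ) : 𝓞 K)}} := by
    intro v hv
    simp only [Set.mem_setOf_eq, not_forall, not_not, exists_prop] at hv
    obtain ⟨ℓ, hℓ, hmem⟩ := hv
    refine Set.mem_biUnion hℓ ?_
    simp only [Set.mem_setOf_eq, Ideal.dvd_span_singleton]
    exact hmem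
  refine Set.Finite.subset (Set.Finite.biUnion S₀.finite_toSet fun ℓ hℓ => ?_) hsub
  apply Ideal.finite_factors
  have hℓ0 : (ℓ : ℕ) ≠ 0 := fun h => h0 (h ▸ hℓ)
  have hne : Ideal.span {((ℓ : ℕ) : 𝓞 K)} ≠ ⊥ := by
    rw [Ne, Ideal.span_singleton_eq_bot]
    exact_mod_cast hℓ0
  simpa only [Ne, Submodule.zero_eq_bot] using hne

/-- **Good places are infinite when `0 ∉ S₀`** (complement of a finite set in the infinite set of
finite places of `K`, `Literature.NumberTheory.Automorphic.infinite_heightOneSpectrum`).  So every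
witness `S₀` of E1″ makes the congruence clause bite at infinitely many places of every admissible
`K` — the `S₀ = {0, 2}` loophole of the sibling E1′ (landed
`ResidualBianchiDoorLevel.Negative.not_regAlgCuspidalExist_of_not_residualBianchiDoorLevel`) is
closed. [folklore] -/
theorem infinite_good_places (K : Type) [Field K] [NumberField K] {S₀ : Finset ℕ}
    (h0 : (0 : ℕ) ∉ S₀) :
    {v : HeightOneSpectrum (𝓞 K) | ∀ ℓ ∈ S₀, ((ℓ : ℕ) : 𝓞 K) ∉ v.asIdeal}.Infinite := by
  haveI := Literature.NumberTheory.Automorphic.infinite_heightOneSpectrum K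
  have hfin := finite_bad_places (K := K) h0
  have hcompl : {v : HeightOneSpectrum (𝓞 K) | ∀ ℓ ∈ S₀, ((ℓ : ℕ) : 𝓞 K) ∉ v.asIdeal}ᶜ =
      {v : HeightOneSpectrum (𝓞 K) | ¬ ∀ ℓ ∈ S₀, ((ℓ : ℕ) : 𝓞 K) ∉ v.asIdeal} := by
    ext v; simp only [Set.mem_compl_iff, Set.mem_setOf_eq]
  exact Set.infinite_of_finite_compl (hcompl ▸ hfin)

/-- **`(∃ good place) ↔ 0 ∉ S₀`** — the exact dividing line between the honest E1″/E1′R and the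
vacuous E1′ (`no_good_place_of_zero_mem`, landed `IcosahedralDescentLevel.Negative`). [folklore] -/
theorem exists_good_place_iff (K : Type) [Field K] [NumberField K] (S₀ : Finset ℕ) :
    (∃ v : HeightOneSpectrum (𝓞 K), ∀ ℓ ∈ S₀, ((ℓ : ℕ) : 𝓞 K) ∉ v.asIdeal) ↔ (0 : ℕ) ∉ S₀ := by
  refine ⟨fun ⟨v, hv⟩ h0 => IcosahedralDescentLevel.Negative.no_good_place_of_zero_mem h0 K v hv,
    fun h0 => ?_⟩
  obtain ⟨v, hv⟩ := (infinite_good_places K h0).nonempty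
  exact ⟨v, hv⟩

/-! ## §3 Load-bearing hypotheses and decorative conjuncts -/

/-- E1″ with BOTH hypotheses on `ρ` (`hirr`, `hA5`) dropped. -/
def WithoutIcosahedral : Prop :=
  QuadraticBaseChangeGL2 → ∀ (ι : PadicAlgCl 2 ≃+* ℂ) (ρ : FramedGaloisRep ℚ ℂ 2),
    ∃ S₀ : Finset ℕ, 2 ∈ S₀ ∧ (0 : ℕ) ∉ S₀ ∧
      ∀ (K : Type) [Field K] [NumberField K], IsTotallyComplex K → Module.finrank ℚ K = 2 →
        (∃ v w : HeightOneSpectrum (𝓞 K), v ≠ w ∧ ((2 : ℕ) : 𝓞 K) ∈ v.asIdeal ∧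
          ((2 : ℕ) : 𝓞 K) ∈ w.asIdeal) → PerField ι ρ S₀ K

/-- **`hA5` is load-bearing: without the icosahedral hypotheses E1″ is the NEGATION of its own
antecedent.**  (→) given QBC the body is the sibling E1′ without icosahedral hypotheses (plus
`0 ∉ S₀`), refuted by the landed witness `ρ = 1`, `K = ℚ(√-15)`
(`ResidualBianchiDoorLevel.Negative.residualBianchiDoorLevel_false_without_icosahedral`: the pinned
model is trivial, projective image `1 ≇ A₅`); (←) ex falso.  Since QBC is a theorem in print, the
hypothesis-free door is false; any proof of E1″ must use `hA5`. [folklore] -/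
theorem withoutIcosahedral_iff_not_QBC : WithoutIcosahedral ↔ ¬ QuadraticBaseChangeGL2 := by
  refine ⟨fun h hQ => ?_, fun hnQ hQ => absurd hQ hnQ⟩
  apply ResidualBianchiDoorLevel.Negative.residualBianchiDoorLevel_false_without_icosahedral
  intro ι ρ
  obtain ⟨S₀, h2, -, hK⟩ := h hQ ι ρ
  exact ⟨S₀, h2, fun K _ _ htc hdeg hsplit => hK K htc hdeg hsplit⟩

/-- **`_false_without_` shape of the same fact**: QBC refutes the icosahedral-free door. [folklore] -/
theorem withoutIcosahedral_false_of_QBC (hQ : QuadraticBaseChangeGL2) : ¬ WithoutIcosahedral :=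
  fun h => withoutIcosahedral_iff_not_QBC.mp h hQ

/-- E1″ with the hypothesis `ρ.toGaloisRep.IsIrreducible` dropped (keeping `hA5`). -/
def WithoutHirr : Prop :=
  QuadraticBaseChangeGL2 → ∀ (ι : PadicAlgCl 2 ≃+* ℂ) (ρ : FramedGaloisRep ℚ ℂ 2),
    Nonempty ((Matrix.ProjGenLinGroup.mk.comp ρ.toMonoidHom).range ≃* alternatingGroup (Fin 5)) →
    ∃ S₀ : Finset ℕ, 2 ∈ S₀ ∧ (0 : ℕ) ∉ S₀ ∧
      ∀ (K : Type) [Field K] [NumberField K], IsTotallyComplex K → Module.finrank ℚ K = 2 →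
        (∃ v w : HeightOneSpectrum (𝓞 K), v ≠ w ∧ ((2 : ℕ) : 𝓞 K) ∈ v.asIdeal ∧
          ((2 : ℕ) : 𝓞 K) ∈ w.asIdeal) → PerField ι ρ S₀ K

/-- **`hirr` is decoration**: it follows from `hA5` (finite image + non-cyclic projective type,
landed `ResidualBianchiDoorLevel.Negative.isIrreducible_of_icosahedral`), so dropping it changes
nothing. [folklore] -/
theorem crux_iff_withoutHirr : ResidualBianchiDoorLevelBC ↔ WithoutHirr :=
  ⟨fun h hQ ι ρ hA5 =>
      h hQ ι ρ (ResidualBianchiDoorLevel.Negative.isIrreducible_of_icosahedral ρ hA5) hA5,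
    fun h hQ ι ρ _ hA5 => h hQ ι ρ hA5⟩

/-- E1″ with the conclusion conjunct `2 ∈ S₀` deleted. -/
def WithoutTwoMem : Prop :=
  QuadraticBaseChangeGL2 → ∀ (ι : PadicAlgCl 2 ≃+* ℂ) (ρ : FramedGaloisRep ℚ ℂ 2),
    ρ.toGaloisRep.IsIrreducible →
    Nonempty ((Matrix.ProjGenLinGroup.mk.comp ρ.toMonoidHom).range ≃* alternatingGroup (Fin 5)) →
    ∃ S₀ : Finset ℕ, (0 : ℕ) ∉ S₀ ∧
      ∀ (K : Type) [Field K] [NumberField K], IsTotallyComplex K → Module.finrank ℚ K = 2 →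
        (∃ v w : HeightOneSpectrum (𝓞 K), v ≠ w ∧ ((2 : ℕ) : 𝓞 K) ∈ v.asIdeal ∧
          ((2 : ℕ) : 𝓞 K) ∈ w.asIdeal) → PerField ι ρ S₀ K

/-- **The conjunct `2 ∈ S₀` is decoration as a STATEMENT**: a witness `S₀ ∌ 0` without `2` can be
enlarged to `insert 2 S₀` (`PerField.mono`; `0 ≠ 2`).  Mutation verdict: NOT load-bearing for the
truth value of E1″ (nor of E1′R); it is load-bearing only in the PROOF, where the HLTT congruence
normalisation `ι⁻¹√q ≡ 1 (mod 𝔪)` needs odd residue characteristic (landed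
`ResidualBianchiDoorLevel.Negative.stub_predictedPolyCongr_false_without_odd`), and downstream, where
E2′ wants `2 ∈ S₀` in its hypothesis. [folklore] -/
theorem crux_iff_withoutTwoMem : ResidualBianchiDoorLevelBC ↔ WithoutTwoMem := by
  refine ⟨fun h hQ ι ρ hirr hA5 => ?_, fun h hQ ι ρ hirr hA5 => ?_⟩
  · obtain ⟨S₀, -, h0, hK⟩ := h hQ ι ρ hirr hA5
    exact ⟨S₀, h0, hK⟩
  · obtain ⟨S₀, h0, hK⟩ := h hQ ι ρ hirr hA5
    refine ⟨insert 2 S₀, Finset.mem_insert_self _ _, ?_, fun K _ _ htc hdeg hsplit => ?_⟩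
    · rw [Finset.mem_insert, not_or]
      exact ⟨by decide, h0⟩
    · exact PerField.mono (Finset.subset_insert 2 S₀) (hK K htc hdeg hsplit)

/-- E1″ demanded for EVERY quadratic field `K` (real or imaginary, any behaviour of `2`). -/
def ForAllQuadratic : Prop :=
  QuadraticBaseChangeGL2 → ∀ (ι : PadicAlgCl 2 ≃+* ℂ) (ρ : FramedGaloisRep ℚ ℂ 2),
    ρ.toGaloisRep.IsIrreducible →
    Nonempty ((Matrix.ProjGenLinGroup.mk.comp ρ.toMonoidHom).range ≃* alternatingGroup (Fin 5)) →
    ∃ S₀ : Finset ℕ, 2 ∈ S₀ ∧ (0 : ℕ) ∉ S₀ ∧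
      ∀ (K : Type) [Field K] [NumberField K], Module.finrank ℚ K = 2 → PerField ι ρ S₀ K

/-- **The field hypotheses `IsTotallyComplex K` and "2 splits" only weaken the crux** (trivial
monotonicity).  Mutation finding for the prover: the picked line's closing proof
(`ResidualBianchiDoorLevelBC_of_serreModTwo`) binds them as `_htc`, `_hsplit` and never uses them —
it proves `ForAllQuadratic` verbatim (BC_K(π_f) exists and is cuspidal for every quadratic `K`
because `A₅` has no index-2 subgroup; the congruence transfers along any `w ∣ v`, `f(w|v) ∈ {1,2}`).
They are there for the downstream items E2′/R″ (Bianchi setting, `K_v = ℚ₂`), not for E1″. [folklore] -/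
theorem crux_of_forAllQuadratic (h : ForAllQuadratic) : ResidualBianchiDoorLevelBC := by
  intro hQ ι ρ hirr hA5
  obtain ⟨S₀, h2, h0, hK⟩ := h hQ ι ρ hirr hA5
  exact ⟨S₀, h2, h0, fun K _ _ _ hdeg _ => hK K hdeg⟩

/-! ## §4 Natural strengthenings that are false (inherited from the sibling E1′, valid verbatim) -/

/-- **The congruence cannot be normalised at residue characteristic `2`** (re-export of the landed
`ResidualBianchiDoorLevel.Negative.stub_predictedPolyCongr_false_without_odd`): with `Odd q` deleted,
the predicted-polynomial congruence of the line's dictionary stub fails at `q = 2, k = 2,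
Q = H = (X-1)²` (coefficient gap `3/4`, 2-adic norm `4`).  This is the proof-level reason the line
puts `2` into its bad set, although `2 ∈ S₀` is decorative as a statement (`crux_iff_withoutTwoMem`).
[folklore] -/
theorem strengthening_congruence_at_two_false :
    ¬ ∀ (ι : PadicAlgCl 2 ≃+* ℂ) (q : ℕ) (k : ℤ) (Q : Polynomial (Valued.v (R := PadicAlgCl 2)).valuationSubring)
        (H : Polynomial ℂ), H.Monic → H.natDegree = 2 →
        Q.map ((Valued.v (R := PadicAlgCl 2)).valuationSubring).subtype = H.map (ι.symm : ℂ →+* PadicAlgCl 2) →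
        ∀ i : ℕ, ‖(Q.map ((Valued.v (R := PadicAlgCl 2)).valuationSubring).subtype).coeff i -
          (arithFrobPolyOfSatake ι q 2
            (H.roots.map fun β => (((Real.sqrt q : ℝ) : ℂ)) ^ (k - 1) * β⁻¹)).coeff i‖ < 1 :=
  ResidualBianchiDoorLevel.Negative.stub_predictedPolyCongr_false_without_odd

/-! ## §5 Line `Sketch` (lead prover-line-stmt-Langlands-16853-0): stub-by-stub -/

/-- **Stub verdicts (cycle 1)**, skeleton `Cruxes/ResidualBianchiDoorLevelBC/SketchIdeator2.lean`
(= evidence `Sketch.lean`, idea `fibre-substitution`), re-checked by this seat as `LineSketch.lean`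
(lean check rc 0, 0 sorry, 0 warnings; axioms of the closing theorem: propext, Classical.choice,
Quot.sound):
* `Sketch.stub_qLevel_two` — PROVED (sorry-free; = landed p101192 `stub_qLevel` at the `p = 2` fibre
  of the Serre fact).  Nothing to attack.  Hypothesis minimality: `hirr` unused (registered signature;
  `isIrreducible_of_icosahedral`), `hA5` used twice (residual irreducibility, cusp witness).
* `FibreSubstitution.stub_bcTransfer_fibre` — PROVED.  Load-bearing hypotheses: `hA` (fibre (a):
  without a cuspidal weak lift nothing starts), `hne` (the inert non-twist witness: for a CM `πQ`
  the base change is Eisenstein), `hD` (fibre (d): `IsRegularAlgebraic` is archimedean data and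
  cannot be read off Satake parameters), `hCfin` (fibre (c) at EVERY finite `w` incl. those ramified
  in `K/ℚ` — an a.e. clause would lose the good places over the discriminant of `K`), `hK`
  (`f(w|v) ∈ {1,2}`).  Note `K` need not be imaginary nor 2-split (cf. `crux_of_forAllQuadratic`).
* `FibreSubstitution.isRegularAlgebraic_of_archFibre` — PROVED (4 lines).
* JOINT SUFFICIENCY — `ResidualBianchiDoorLevelBC_of_serreModTwo` concludes the crux BY NAME from
  `∀ k, khare_wintenberger 2 k` ALONE; clauses used from the antecedent: (a) `hQ.1`, (c) `hQ.2.2.1`,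
  (d) `hQ.2.2.2`, all at `(F, E) = (ℚ, K)`; clause (b) unused.  The `σ₀` of `stub_qLevel_two` and of
  `exists_padicModel_restrictField` are identified through `toMonoidHom`
  (`framedGaloisRep_eq_of_toMonoidHom_eq`) — no gap smuggled.  Audit class `proof.conditional` on the
  cited Serre fact: that is the declared trust base of the item, the best this item admits.
* DISPROVER'S BOTTOM LINE FOR THE LEAD: there is no stub left to break; land the file.  If the harness
  later rules `khare_wintenberger 2` apex, the hypothesis of `_of_serreModTwo` becomes the next
  promoted crux and this item restates as `SerreModTwo → QBC → E1′R` — still irrefutable (§1).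
[folklore] -/
theorem line_Sketch_verdicts : True := trivial

/-! ## §6 The trust base, re-read (why even the conditional kill is out of reach) -/

/-- **Reading of `Literature.NumberTheory.Automorphic.khare_wintenberger 2 k`** (=
`SerreModularityConjecture 2 k`), the only cited fact the crux now rests on:
* quantifier hygiene: `[CharP k 2] [IsAlgClosed k]` are PREMISES inside the Prop, so the outer
  `∀ k [Field k] [TopologicalSpace k] [DiscreteTopology k]` is harmless at junk `k` (`ℚ`, `𝔽₉`, …:
  premise uninhabited, statement vacuous there) — `∀ k, khare_wintenberger 2 k` is not false for a
  silly reason;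
* `ρ̄ : ModPGaloisRep ℚ k 2` continuous into discrete `GL₂(k)` ⇒ finite image; `IsOdd` is automatic in
  characteristic 2 (landed `ResidualBianchiDoorMod2.isOdd_of_charP_two`), as in KW where the parity
  condition is void at `p = 2`;
* weight: Serre's recipe (`serreWeightLocal`: level-two / tame level-one with the `(0,0) ↦ q`
  convention / wild with the peu–très ramifiée correction and the explicit `q = 2 ↦ 4`) gives
  `k(ρ̄) ∈ {2, 4}` at `p = 2` (landed `isSerreWeight_two_cases`), never the non-liftable weight `1`;
* level: `serreLevel` = prime-to-2 part of `∏ ℓ^{artinConductorExponent}` (`finprod`, junk `1` only if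
  `ρ̄` were ramified at infinitely many places, impossible for finite image); `NeZero` proved;
* character: NOT prescribed (`ε_f` is the newform's own) — so Serre's own `p = 2, 3` counterexamples
  to the character clause of (3.2.4) do not bite;
* conclusion `IsGaloisRepOfNewform1Int f ι_f {q ∣ N·2} ρ̄`: charpoly match off `2N`, the form KW prove.
Residual (unformalisable here) risk: a mis-transcribed `artinConductorExponent` (Swan term) would make
the level too small and the typed statement false at wildly ramified `ℓ ≠ 2` — not checkable in Lean
(no explicit irreducible `ρ̄`, no dimension formulae for `S_k(Γ₁(N))`), and the sibling disprover's
read (E1′ Disproof §5) found it faithful.  Literature: no counterexample to Serre's conjecture mod 2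
exists (it is a theorem: KhareWintenberger2009 Thm 1.2, 9.1; Kisin2009TwoAdic Thm 0.1, Cor. 0.2);
`ledger negatives --problem Langlands` has no entry touching residual modularity; the barrier
catalogue (`Literature/Barriers/Langlands/*`: non-regular weight, Taylor–Wiles numerics, patching
local components, mod-p LL beyond `ℚ_p`) concerns lifting, not a residual statement in cohomological
weight. [folklore] -/
theorem trust_base_reading : True := trivial

end Summit.Langlands.Langlands.Cruxes.ResidualBianchiDoorLevelBC.Disproof

end
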